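import Literature.MathematicalPhysics.QuantumLattice.SpinChainsLiebMattisSpinProofs
import Literature.MathematicalPhysics.QuantumLattice.HubbardSectorEnclosureCertificate
import HarnessLib

/-!
# The central `S^z` sector carries the ground-state energy of an `SU(2)`-invariant spin
# Hamiltonian; sector-block enclosure certificates for the Heisenberg model

Topic `MathematicalPhysics/QuantumLattice`; the spin-system companion of
`HubbardSectorEnclosureCertificate.lean`. For the spin-`n/2` Heisenberg Hamiltonian
`H = heisenbergHamiltonian n G J` on ANY finite graph and ANY real `J`, the sector energies
`E(M) = lowestEnergyInSector n H M` (`M = |Λ| n/2 - W`, `W` = weight `Σ_x σ_x` of the configurations)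
satisfy `E(M - 1) ≤ E(M)` for `M > 0` (lowering, the tree's `LiebMattis.lowestEnergyInSector_succ_le`)
and — proved here — `E(M + 1) ≤ E(M)` for `M < 0` (raising, `LiebMattis.lowestEnergyInSector_le_succ_of_neg`);
hence when `|Λ| n` is even the central sector `M = 0` (weight `W_c`, `2 W_c = |Λ| n`) has the least
sector energy and

* `LiebMattis.lowestEnergyInSector_central_eq_groundEnergy` — **`E(M = 0) = E₀(H)`** (every spin
  multiplet meets `S^z = 0`; no bipartiteness and no sign of `J` needed — compare the tree's
  Lieb–Mattis theorem `lowestEnergyInSector_weight_eq_groundEnergy`, which needs both).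

So an exact-diagonalisation certificate may work in the `S^z = 0` block alone:

* `Heisenberg.weightPred n W` — the configuration predicate `Σ_x σ_x = W` of the sector block;
* `heisenberg_groundEnergy_ge_of_centralBlock_posSemidef` — if
  `H.toBlock (weightPred n W_c) (weightPred n W_c) - c·1 ⪰ 0` then `c ≤ E₀(H)`;
* `heisenberg_groundEnergy_ge_of_central_gram_certificate` — the Gram–Gershgorin form
  `B - σ·1 = s⁻¹ • (Rᴴ R - E)`, `E` Hermitian with absolute row sums `≤ r` ⇒ `σ - r/s ≤ E₀(H)`
  (`posSemidef_sub_of_gram_certificate`);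
* `heisenberg_groundEnergy_le_of_trial` — the upper half, `E₀(H) ≤ Re⟨ψ, H ψ⟩` for a unit `ψ`
  (any sector).

Standard material: H. Tasaki, *Physics and Mathematics of Quantum Many-Body Systems* (2020), §2.4
(before Thm 2.3: "trivially `E(M) ≤ E(M')` for `|M| ≤ |M'|`") and App. A.3; E. H. Lieb, D. Mattis,
J. Math. Phys. 3 (1962) 749. No named facts; the one definition is the weight predicate.
-/

noncomputable section

open Matrix Finset Complex
open scoped ComplexOrder BigOperators

namespace Literature.MathematicalPhysics.QuantumLattice

namespace LiebMattis

section QLattice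

variable {Λ : Type*} [Fintype Λ] [DecidableEq Λ] (n : ℕ) (G : SimpleGraph Λ) [DecidableRel G.Adj] (J : ℝ)

/-- **`E(W) ≤ E(W+1)` for `|Λ| n < 2(W+1)`**, i.e. `E(M + 1) ≤ E(M)` for every NEGATIVE magnetisation
`M = |Λ| n/2 - (W+1) < 0`: a ground state of the sector of weight `W + 1` is not a highest-weight vector
(`raise_mulVec_ne_zero_of_neg`), so `Ŝ⁺_tot` maps it to a nonzero eigenvector of `H` with the same
energy in the sector of weight `W`. Tasaki (2020) §2.4 (before Thm 2.3), App. A.3. [folklore] -/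
theorem lowestEnergyInSector_le_succ_of_neg (W : ℕ) (hW : Fintype.card Λ * n < 2 * (W + 1))
    (hW' : W + 1 ≤ Fintype.card Λ * n) :
    lowestEnergyInSector n (heisenbergHamiltonian n G J) (((Fintype.card Λ * n : ℕ) : ℝ) / 2 - W) ≤
      lowestEnergyInSector n (heisenbergHamiltonian n G J)
        (((Fintype.card Λ * n : ℕ) : ℝ) / 2 - (W + 1 : ℕ)) := by
  obtain ⟨⟨ψ, hψ, hψ0, hHψ⟩, -⟩ :=
    sector_groundState_weight n G J (W + 1) (exists_weight_eq n (W + 1) hW')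
  have hM : ((Fintype.card Λ * n : ℕ) : ℝ) / 2 - (W + 1 : ℕ) < 0 := by
    have : ((Fintype.card Λ * n : ℕ) : ℝ) < (2 * (W + 1) : ℕ) := by exact_mod_cast hW
    push_cast at this ⊢
    linarith
  have hne := raise_mulVec_ne_zero_of_neg n hM hψ hψ0
  exact lowestEnergyInSector_le_of_eigenvector n G J W (raise_mulVec_mem n hψ) hne
    (mulVec_eigenvector_of_commute n (commute_heisenbergHamiltonian_raise n G J) hHψ)

/-- **The central sector has the least sector energy**: if `2 W_c = |Λ| n` (magnetisation `0`), then
`E(W_c) ≤ E(W)` for every weight `W ≤ |Λ| n` — by lowering from positive magnetisations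
(`lowestEnergyInSector_succ_le`) and raising from negative ones
(`lowestEnergyInSector_le_succ_of_neg`). Any graph, any real `J`. Tasaki (2020) §2.4. [folklore] -/
theorem lowestEnergyInSector_central_le (Wc : ℕ) (hc : 2 * Wc = Fintype.card Λ * n) (W : ℕ)
    (hW : W ≤ Fintype.card Λ * n) :
    lowestEnergyInSector n (heisenbergHamiltonian n G J) (((Fintype.card Λ * n : ℕ) : ℝ) / 2 - Wc) ≤
      lowestEnergyInSector n (heisenbergHamiltonian n G J) (((Fintype.card Λ * n : ℕ) : ℝ) / 2 - W) := by
  rcases le_or_gt W Wc with hle | hgt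
  · -- `W ≤ Wc`: lower from `W` up to `Wc`
    have key : ∀ d : ℕ, ∀ W : ℕ, W + d = Wc →
        lowestEnergyInSector n (heisenbergHamiltonian n G J) (((Fintype.card Λ * n : ℕ) : ℝ) / 2 - Wc) ≤
          lowestEnergyInSector n (heisenbergHamiltonian n G J)
            (((Fintype.card Λ * n : ℕ) : ℝ) / 2 - W) := by
      intro d
      induction d with
      | zero => intro W h; rw [show W = Wc by omega]
      | succ d ih =>
        intro W h
        exact (ih (W + 1) (by omega)).trans (lowestEnergyInSector_succ_le n G J W (by omega))
    exact key (Wc - W) W (by omega)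
  · -- `Wc < W`: raise from `W` down to `Wc`
    have key : ∀ d : ℕ, ∀ W : ℕ, W = Wc + d → W ≤ Fintype.card Λ * n →
        lowestEnergyInSector n (heisenbergHamiltonian n G J) (((Fintype.card Λ * n : ℕ) : ℝ) / 2 - Wc) ≤
          lowestEnergyInSector n (heisenbergHamiltonian n G J)
            (((Fintype.card Λ * n : ℕ) : ℝ) / 2 - W) := by
      intro d
      induction d with
      | zero => intro W h _; rw [show W = Wc by omega]
      | succ d ih =>
        intro W h hW
        have h1 := ih (Wc + d) rfl (by omega)
        have h2 := lowestEnergyInSector_le_succ_of_neg n G J (Wc + d) (by omega) (by omega)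
        rw [h]
        exact h1.trans h2
    exact key (W - Wc) W (by omega) hW

/-- **The central sector carries the ground-state energy**: if `|Λ| n` is even, `2 W_c = |Λ| n`, then
`E(S^z = 0) = E₀(H)` for the Heisenberg Hamiltonian on any finite graph with any real `J` — a ground
state has a nonzero weight component, an eigenvector with energy `E₀` in some sector `W₀`, and
`E(W_c) ≤ E(W₀) = E₀ ≤ E(W_c)`. (Every spin multiplet has a member with `S^z = 0`.) Tasaki (2020) §2.4;
Lieb–Mattis (1962). [folklore] -/
theorem lowestEnergyInSector_central_eq_groundEnergy (Wc : ℕ) (hc : 2 * Wc = Fintype.card Λ * n) :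
    lowestEnergyInSector n (heisenbergHamiltonian n G J) (((Fintype.card Λ * n : ℕ) : ℝ) / 2 - Wc) =
      (heisenbergHamiltonian n G J).groundEnergy := by
  refine le_antisymm ?_
    (groundEnergy_le_lowestEnergyInSector n G J Wc (exists_weight_eq n Wc (by omega)))
  have hH := heisenbergHamiltonian_isHermitian n G J
  haveI : Nonempty (TensorIndex Λ (n + 1)) := ⟨fun _ => 0⟩
  obtain ⟨Φ, hΦ, hΦ0⟩ := (Submodule.ne_bot_iff _).1 (Matrix.groundSpace_ne_bot_holds hH)
  rw [Matrix.mem_groundSpace_iff] at hΦ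
  obtain ⟨W, hWr, hW0⟩ : ∃ W ∈ Finset.range (Fintype.card Λ * n + 1),
      (fun σ : TensorIndex Λ (n + 1) => if (∑ z, (σ z : ℕ)) = W then Φ σ else 0) ≠ 0 := by
    by_contra h
    push Not at h
    apply hΦ0
    rw [← sum_components n Φ]
    exact Finset.sum_eq_zero h
  have hle := lowestEnergyInSector_le_of_eigenvector n G J W (component_mem n Φ W) hW0
    (heisenbergHamiltonian_mulVec_component n G J hΦ W)
  exact (lowestEnergyInSector_central_le n G J Wc hc W
    (Nat.lt_succ_iff.1 (Finset.mem_range.1 hWr))).trans hle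

end QLattice

end LiebMattis

/-! ### Sector-block certificates -/

section Certificates

open LiebMattis

variable {Λ : Type*} [Fintype Λ] [DecidableEq Λ] (n : ℕ) (G : SimpleGraph Λ) [DecidableRel G.Adj] (J : ℝ)

/-- The configuration predicate of the sector of weight `W` (`S^z_tot = |Λ| n/2 - W`):
`Σ_x σ_x = W`; `H.toBlock (weightPred n W) (weightPred n W)` is the sector block an exact
diagonalisation handles. Tasaki (2020) §2.4, eq. (2.4.5). [folklore] -/
def Heisenberg.weightPred (n W : ℕ) (σ : TensorIndex Λ (n + 1)) : Prop := (∑ z, (σ z : ℕ)) = W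

/-- The weight predicate is decidable. [folklore] -/
instance Heisenberg.instDecidablePredWeightPred (n W : ℕ) :
    DecidablePred (Heisenberg.weightPred (Λ := Λ) n W) :=
  fun σ => inferInstanceAs (Decidable ((∑ z, (σ z : ℕ)) = W))

/-- **A PSD sector block bounds the sector Rayleigh quotients**: if
`H.toBlock (weightPred n W) (weightPred n W) - c·1 ⪰ 0`, then `c ≤ Re⟨φ, H φ⟩` for every unit `φ` of the
sector of weight `W`. Tasaki (2020) §2.1. [folklore] -/
theorem Heisenberg.le_re_of_weightBlock_posSemidef (H : Op Λ (n + 1)) {W : ℕ} {c : ℝ}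
    (h : (H.toBlock (Heisenberg.weightPred n W) (Heisenberg.weightPred n W) -
      (c : ℂ) • (1 : Matrix _ _ ℂ)).PosSemidef)
    (φ : TensorIndex Λ (n + 1) → ℂ)
    (hφ : φ ∈ spinZSector (Λ := Λ) n (((Fintype.card Λ * n : ℕ) : ℝ) / 2 - W)) (hφ1 : star φ ⬝ᵥ φ = 1) :
    c ≤ (star φ ⬝ᵥ (H *ᵥ φ)).re := by
  have hsupp : ∀ σ, ¬ Heisenberg.weightPred n W σ → φ σ = 0 := (mem_spinZSector_weight_iff n W φ).1 hφ
  set φ' : {σ : TensorIndex Λ (n + 1) // Heisenberg.weightPred n W σ} → ℂ := fun s => φ s.1 with hφ'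
  have h0 := h.dotProduct_mulVec_nonneg φ'
  rw [sub_mulVec, dotProduct_sub, smul_mulVec, one_mulVec, dotProduct_smul, hφ',
    star_restrict_dotProduct_toBlock_mulVec (Heisenberg.weightPred n W) H φ hsupp,
    star_restrict_dotProduct_restrict (Heisenberg.weightPred n W) φ φ hsupp, hφ1] at h0
  obtain ⟨hre, -⟩ := Complex.nonneg_iff.mp h0
  simp only [Complex.sub_re, smul_eq_mul, mul_one, Complex.ofReal_re] at hre
  linarith

/-- **The central sector block bounds the ground-state energy**: if `2 W_c = |Λ| n` and
`H.toBlock (weightPred n W_c) (weightPred n W_c) - c·1 ⪰ 0` for `H = heisenbergHamiltonian n G J`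
(any finite graph, any real `J`), then `c ≤ E₀(H)`. Tasaki (2020) §2.4. [folklore] -/
theorem heisenberg_groundEnergy_ge_of_centralBlock_posSemidef (Wc : ℕ) (hc : 2 * Wc = Fintype.card Λ * n)
    {c : ℝ}
    (h : ((heisenbergHamiltonian n G J).toBlock (Heisenberg.weightPred n Wc) (Heisenberg.weightPred n Wc) -
      (c : ℂ) • (1 : Matrix _ _ ℂ)).PosSemidef) :
    c ≤ (heisenbergHamiltonian n G J).groundEnergy := by
  rw [← lowestEnergyInSector_central_eq_groundEnergy n G J Wc hc]
  obtain ⟨⟨ψ, hψ, hψ0, -⟩, -⟩ := sector_groundState_weight n G J Wc (exists_weight_eq n Wc (by omega))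
  unfold lowestEnergyInSector Matrix.minEnergyOn
  refine le_csInf ?_ ?_
  · obtain ⟨d, -, hd1⟩ := exists_smul_unit hψ0
    exact ⟨_, d • ψ, Submodule.smul_mem _ _ hψ, hd1, rfl⟩
  · rintro E ⟨φ, hφ, hφ1, rfl⟩
    exact Heisenberg.le_re_of_weightBlock_posSemidef n (heisenbergHamiltonian n G J) h φ hφ hφ1

/-- **Central-sector Gram–Gershgorin certificate for the Heisenberg model** (`2 W_c = |Λ| n`, any graph,
any real `J`): `B - σ·1 = s⁻¹ • (Rᴴ R - E)` on the `S^z = 0` block, `E` Hermitian with absolute row sums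
`≤ r`, `s > 0` ⇒ `σ - r/s ≤ E₀(H)`. [folklore] -/
theorem heisenberg_groundEnergy_ge_of_central_gram_certificate (Wc : ℕ) (hc : 2 * Wc = Fintype.card Λ * n)
    {σ s r : ℝ} {k : Type*} [Fintype k]
    (R : Matrix k {x : TensorIndex Λ (n + 1) // Heisenberg.weightPred n Wc x} ℂ)
    {E : Matrix {x : TensorIndex Λ (n + 1) // Heisenberg.weightPred n Wc x}
      {x : TensorIndex Λ (n + 1) // Heisenberg.weightPred n Wc x} ℂ}
    (hE : E.IsHermitian) (hs : 0 < s) (hrow : ∀ i, ∑ j, ‖E i j‖ ≤ r)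
    (hid : (heisenbergHamiltonian n G J).toBlock (Heisenberg.weightPred n Wc) (Heisenberg.weightPred n Wc) -
      (σ : ℂ) • (1 : Matrix _ _ ℂ) = ((s⁻¹ : ℝ) : ℂ) • (Rᴴ * R - E)) :
    σ - r / s ≤ (heisenbergHamiltonian n G J).groundEnergy :=
  heisenberg_groundEnergy_ge_of_centralBlock_posSemidef n G J Wc hc
    (posSemidef_sub_of_gram_certificate R hE hs hrow hid)

/-- **The upper half**: every unit vector gives `E₀(H) ≤ Re⟨ψ, H ψ⟩` (restated for certificates with an
exact rational `ψ`, e.g. a rounded eigenvector of the central block). Tasaki (2020) §2.1. [folklore] -/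
theorem heisenberg_groundEnergy_le_of_trial (ψ : TensorIndex Λ (n + 1) → ℂ) (hψ1 : star ψ ⬝ᵥ ψ = 1) :
    (heisenbergHamiltonian n G J).groundEnergy ≤ (star ψ ⬝ᵥ (heisenbergHamiltonian n G J *ᵥ ψ)).re := by
  haveI : Nonempty (TensorIndex Λ (n + 1)) := ⟨fun _ => 0⟩
  exact Matrix.groundEnergy_le_rayleigh_holds (heisenbergHamiltonian_isHermitian n G J) ψ hψ1

end Certificates

end Literature.MathematicalPhysics.QuantumLattice

end
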